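import Mathlib.Analysis.InnerProductSpace.Basic

/-!
# `Balaban1983to89.B9Eq349ConjugatedProjection` — T. Bałaban, *Propagators for lattice gauge theories in a background field*, Commun. Math.
# Phys. **99** (1985) 389–434 [Balaban1985BackgroundPropagators] (3.49) p. 399 with (3.25) p. 394 and Thm 3.2 (3.48) p. 398: **THE COMBES–THOMAS
# CONJUGATE `Π = S P S⁻¹` OF THE PROJECTION `P = I − R(U)` IS AN OBLIQUE PROJECTION, BOUNDED THROUGH THE GAP BETWEEN `S(ran A)` AND `S^{−†}(ran A)`:
# `(1 − 3(δ₊ + δ₋)∕√κ₁)·‖S P S⁻¹ x‖ ≤ ‖x‖` — WINDOW `12δ± ≤ √κ₁` ⇒ `‖S P S⁻¹‖ ≤ 2`, AND `‖D₊ S P S⁻¹‖ ≤ 2(3β + √(mC_g + c))`** (letters in, numbers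
# out; radius `∝ √κ₁`, bound `κ₁`-FREE) — route R2′ STEP B8′ S-P5(b) of the pub-balaban NE9 chain, the abstract device

statement-level skeleton of published theorems with citation tags; proofs where landed; nothing here is a claim about the Yang–Mills mass gap

CITATION HEADER (lean-in-tree rule).  Audit cell `pub-balaban`, sub-cell `t4`, BINDER row NE9; filed by NE9 formalisation-swarm leaf prover 06
(`b2b-balaban-t4-ne9-formalise-leaf-06`, gen 65) as the PORT of the NE9 crux-ideation seat's abstract kernel
`t4/ideate/NE9/lens1-NE9ConjugatedProjectionSqrtKappa.lean` (t4-ne9-idea-1 gen 89, sha16 6d75ac87a5d1463f; scratch, never proposed — CREDIT: every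
statement and proof idea below is that kernel's, re-dressed def-free for `𝕜`-LINEAR maps (no continuity is used, so the chain's `→ₗ[ℂ]` objects
`RofU`, `GpOfU`, `Q̃′†` apply verbatim); offered journal l.47455 (first refusal ne9-leaf-01, then ne9-leaf-06 as porter of `B9Eq387CubeLocalisedProjection`)
for `t4/ROUTES-NE9.md` v13.26 R2′ STEP B8′ S-P5(b) «the knot: the η-, m-free unit-scale `L²`-locality of `D P`».  Source READ in the held text
(`paper:balaban1985-cmp99-background-propagators`, journal page = PDF page + 388): p. 399 (3.49), p. 398 Thm 3.2 (3.48), p. 394 (3.25).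

THE PRINT (verbatim).  p. 394 (3.25): *«Rf = (I − G′Q′*(Q′G′²Q′*)⁻¹Q′G′)f, where G′ = G′(U) = (Δ′_a)⁻¹.»*  p. 398 Thm 3.2: *«Under the assumptions of
Theorem 3.1, and with the same constants, the following inequality holds: |(Q′(U)G′²(U)Q′*(U))⁻¹(y, y′)| ≤ B₀ … e^{−δ₀d(y,y′)} (3.48)»*.  p. 399: *«These
theorems imply all the properties of the operator R, or DRD*, we will need in the future. For the operator P = I − R we obtain, using again Lemma 2.1,
[|P(x, x′)|, |(DP)_μ(x, x′)|, |(PD*)_ν(x, x′)|, |(DPD*)_{μν}(x, x′)|] ≤ O(1)[…]e^{−δ₀d(y,y′)} … (3.49)»*.  Print proves (3.48)–(3.49) by generalized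
random-walk expansions (Sect. C); NOTHING of that is asserted here.

WHY (route R2′ STEP B8′, S-P5(b)).  Exponential decay of the kernel of `P = I − R` ((3.49)) is, by Combes–Thomas, a UNIFORM bound on the conjugates
`Π_κ = e^{κχ}Pe^{−κχ}` for `|κ|` below a radius.  The comparand road conjugates the five-factor product `P = G′Q̃′†(Q̃′G′²Q̃′†)⁻¹Q̃′G′` factor by
factor and pays `κ₁⁻¹` for the middle inverse (`κ₁` = the coercivity of the Gram operator, the chain's (S3c) letter): radius `∝ κ₁`, bound `∝ κ₁⁻¹`.
HERE: `Π = S P S⁻¹` is still a projection — the OBLIQUE projection onto `M = S(ran A)` (`A = G′Q̃′†`) whose defect `x − Πx` is killed by the orthogonal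
projection onto `N = ran(S^{−†}A W′)`; two lines of Hilbert-space geometry give `(1 − ‖P_M − P_N‖)‖Πx‖ ≤ ‖x‖`, and the ANCHORED gap lemma (§1,
only the UNconjugated generator `A` coercive) gives `‖P_M − P_N‖ ≤ 3(δ₊ + δ₋)∕√κ₁` with `δ₊ = ‖SAW − A‖`, `δ₋ = ‖S^{−†}AW′ − A‖`: radius `∝ √κ₁`,
bound `κ₁`-FREE (§3).  §4 absorbs the derivative on the conjugated range through the form `H = Δ′_a ≥ D†D` (`H₊A₊ = Q̃′†₊`): the conjugated (I2).

WHAT IS PROVED (sorry-free; proof lane — no `def`, no `Prop` placeholder; [folklore] Hilbert-space algebra over `RCLike 𝕜`; nothing of [B9] asserted).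
* §0 `sqrt_mul_le_of_mul_sq_le`.  §1 RANGE PROJECTIONS BY LETTERS (`P x = A(Tx)`, `P(Ag) = Ag`, `⟪Px, y⟫ = ⟪x, Py⟫`): `proj_idem`, `inner_proj_sub_self`,
  `norm_sq_eq_proj_add`, `norm_proj_le`, `norm_sub_proj_le`, `sqrt_mul_norm_coeff_le`; two projections: `sqrt_sub_mul_norm_le`, `norm_proj_sub_le_delta`,
  `inner_sub_proj_apply_eq_zero`, `norm_sq_proj_le_of_perp`, **`norm_proj_sub_proj_le_anchored`** (`κ₁` at the reference ONLY, window `2δ ≤ √κ₁`: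
  `‖Px − P₁x‖ ≤ (3δ∕√κ₁)‖x‖`; cf. `B9Eq325RLipschitzSqrt.norm_starProjection_sub_le_of_generators`, the `Submodule.starProjection` dress of the same device).
* §2 `norm_le_of_two_proj` (`P_MΠ = Π`, `P_NΠ = P_N`, `‖P_M − P_N‖ ≤ θ` ⇒ `(1 − θ)‖Πx‖ ≤ ‖x‖`), `norm_le_div_of_two_proj`.
* §3 THE CONJUGATE: `inner_S_Sd`, `projM_conj`, `projN_apply_S_sub_eq_zero`, `projN_conj`, **`norm_conjProj_le`**, **`norm_conjProj_le_two`** (`12δ± ≤ √κ₁ ⇒ ‖SPS⁻¹x‖ ≤ 2‖x‖`).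
* §4 **`norm_D_le_on_range`** (`‖Df‖² ≤ re⟪f,Hf⟫`, `H₊(A₊h) = Q̃′†₊h`, `‖Q̃′†₊‖ ≤ m`, `‖h‖ ≤ C_g‖A₊h‖`, `re⟪y,(H − H₊)y⟫ ≤ 2β‖Dy‖‖y‖ + c‖y‖²` ⇒
  `‖D(A₊h)‖ ≤ (2β + √(mC_g + c))‖A₊h‖`), **`norm_conjDP_le_two`** (`‖D₊(SPS⁻¹x)‖ ≤ 2(3β + √(mC_g + c))‖x‖`).  §5 non-vacuity (`example`s).
DICTIONARY for the S-P5(b) porter (words, nothing lattice is asserted): `E` = sites, `G` = blocks, `B` = bonds; `P = 1 − R(U)` (`B9Eq326OperatorAssembly.RofU`;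
`hPA`∕`hfix` from S3a `B9Eq325ProjFormula.RofU_eq_formula` ∕ `inner_formula_rem_eq_zero`, `A = G′(U)Q̃′(U)†`, `T = (Q̃′G′²Q̃′†)⁻¹Q̃′G′`, `κ₁` from
`inner_qggq_eq` + a (S3c) certificate); `S = e^{κχ}`, `Sinv = e^{−κχ}`, `Sd = e^{−κ̄χ}`, `W, W′` block weights (`A₊ = SAW`, `A₋ = SdAW′`; `δ±` from the
conjugation letters of `D`, `Q′` — `B9Eq3101ConjugationLetters` when landed — and of `G′`); `H = Δ′_a(U)`, `H₊ = SHS⁻¹`, `D₊ = S_BDS⁻¹`.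
HONEST SCOPE.  Symbolic; no lattice, no decay rate, no number for `κ₁` (the cell's `κ(1)` request R-NE9-leaf06-g64-KAPPA1 is open); ONE device of ONE
sub-step of a route step, NOT NE9 (cell pub-balaban: NE9 NOT PRINTED ∕ NOT PROVED; «NE9 ⇐ the named binders»; spine PROVED 0∕9; rung (B)+1 on a finite T⁴ —
NOT infinite volume, NOT mass gap, NOT Clay; HONEST DEPENDENCY: continuum YM on T⁴ ⇐ BetaPertH ∧ nine spine estimates (0/9 proved); BetaPertH ⇐ (D1) ∧ (D4) ∧
CAP+tail; G-an2-4 gates asym, D1 and NE2/3/4).  NEW file, Mathlib-only imports; nothing modified.  Net new unproved facts: 0.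
-/

namespace Literature.MathematicalPhysics.QuantumFieldTheory.Balaban1983to89.B9Eq349ConjugatedProjection

open scoped InnerProductSpace

variable {𝕜 : Type*} [RCLike 𝕜] {E : Type*} [NormedAddCommGroup E] [InnerProductSpace 𝕜 E]
  {G : Type*} [NormedAddCommGroup G] [Module 𝕜 G] {B : Type*} [NormedAddCommGroup B] [Module 𝕜 B]

/-! ## §0 A scalar lemma -/

/-- `κa² ≤ b²`, `a, b ≥ 0` ⇒ `√κ·a ≤ b` (from a Gram-side coercivity to a generator-side one). [folklore] [cite: Balaban1985BackgroundPropagators, Thm 3.2 (3.48) p.398] -/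
theorem sqrt_mul_le_of_mul_sq_le {κ a b : ℝ} (ha : 0 ≤ a) (hb : 0 ≤ b) (h : κ * a ^ 2 ≤ b ^ 2) : Real.sqrt κ * a ≤ b := by
  calc Real.sqrt κ * a = Real.sqrt κ * Real.sqrt (a ^ 2) := by rw [Real.sqrt_sq ha]
    _ = Real.sqrt (κ * a ^ 2) := (Real.sqrt_mul' κ (sq_nonneg a)).symm
    _ ≤ Real.sqrt (b ^ 2) := Real.sqrt_le_sqrt h
    _ = b := Real.sqrt_sq hb

/-! ## §1 Range projections by letters: `P x = A (T x)`, `P (A g) = A g`, `⟪P x, y⟫ = ⟪x, P y⟫` -/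

section One

variable {A : G →ₗ[𝕜] E} {P : E →ₗ[𝕜] E} {T : E → G}

/-- `P = A ∘ T` and `P` fixes `range A` ⇒ `P` is idempotent. [folklore] [cite: Balaban1985BackgroundPropagators, (3.21) p.394, (3.25) p.394] -/
theorem proj_idem (hPA : ∀ x, P x = A (T x)) (hfix : ∀ g, P (A g) = A g) (x : E) : P (P x) = P x := by
  rw [hPA x, hfix]

/-- … and with symmetry, `P x ⊥ x − P x`. [folklore] [cite: Balaban1985BackgroundPropagators, (3.21) p.394] -/
theorem inner_proj_sub_self (hPA : ∀ x, P x = A (T x)) (hfix : ∀ g, P (A g) = A g) (hsa : ∀ x y, ⟪P x, y⟫_𝕜 = ⟪x, P y⟫_𝕜) (x : E) :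
    ⟪P x, x - P x⟫_𝕜 = 0 := by
  rw [inner_sub_right, hsa x x, hsa x (P x), proj_idem hPA hfix, sub_self]

/-- Pythagoras: `‖x‖² = ‖P x‖² + ‖x − P x‖²`. [folklore] [cite: Balaban1985BackgroundPropagators, (3.21) p.394] -/
theorem norm_sq_eq_proj_add (hPA : ∀ x, P x = A (T x)) (hfix : ∀ g, P (A g) = A g) (hsa : ∀ x y, ⟪P x, y⟫_𝕜 = ⟪x, P y⟫_𝕜) (x : E) :
    ‖x‖ ^ 2 = ‖P x‖ ^ 2 + ‖x - P x‖ ^ 2 := by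
  have h := norm_add_sq_eq_norm_sq_add_norm_sq_of_inner_eq_zero (P x) (x - P x) (inner_proj_sub_self hPA hfix hsa x)
  have e : P x + (x - P x) = x := by abel
  rw [e] at h
  simpa only [sq] using h

/-- `‖P x‖ ≤ ‖x‖`. [folklore] [cite: Balaban1985BackgroundPropagators, (3.21) p.394] -/
theorem norm_proj_le (hPA : ∀ x, P x = A (T x)) (hfix : ∀ g, P (A g) = A g) (hsa : ∀ x y, ⟪P x, y⟫_𝕜 = ⟪x, P y⟫_𝕜) (x : E) :
    ‖P x‖ ≤ ‖x‖ := by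
  have h := norm_sq_eq_proj_add hPA hfix hsa x
  have h2 : ‖P x‖ * ‖P x‖ ≤ ‖x‖ * ‖x‖ := by nlinarith [h, sq_nonneg ‖x - P x‖]
  exact (mul_self_le_mul_self_iff (norm_nonneg _) (norm_nonneg _)).mpr h2

/-- `‖x − P x‖ ≤ ‖x‖`. [folklore] [cite: Balaban1985BackgroundPropagators, (3.21) p.394] -/
theorem norm_sub_proj_le (hPA : ∀ x, P x = A (T x)) (hfix : ∀ g, P (A g) = A g) (hsa : ∀ x y, ⟪P x, y⟫_𝕜 = ⟪x, P y⟫_𝕜) (x : E) :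
    ‖x - P x‖ ≤ ‖x‖ := by
  have h := norm_sq_eq_proj_add hPA hfix hsa x
  have h2 : ‖x - P x‖ * ‖x - P x‖ ≤ ‖x‖ * ‖x‖ := by nlinarith [h, sq_nonneg ‖P x‖]
  exact (mul_self_le_mul_self_iff (norm_nonneg _) (norm_nonneg _)).mpr h2

/-- `κ‖g‖² ≤ ‖A g‖²` ⇒ `√κ·‖T x‖ ≤ ‖P x‖`. [folklore] [cite: Balaban1985BackgroundPropagators, Thm 3.2 (3.48) p.398, (3.25) p.394] -/
theorem sqrt_mul_norm_coeff_le (hPA : ∀ x, P x = A (T x)) {κ : ℝ} (hκ : ∀ g, κ * ‖g‖ ^ 2 ≤ ‖A g‖ ^ 2) (x : E) :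
    Real.sqrt κ * ‖T x‖ ≤ ‖P x‖ := by
  rw [hPA x]
  exact sqrt_mul_le_of_mul_sq_le (norm_nonneg _) (norm_nonneg _) (hκ (T x))

end One

section Two

variable {A A₁ : G →ₗ[𝕜] E} {P P₁ : E →ₗ[𝕜] E} {T T₁ : E → G}

/-- A generator `δ`-close to a `κ₁`-coercive one is `(√κ₁ − δ)`-coercive. [folklore] [cite: Balaban1985BackgroundPropagators, (3.65)–(3.67) p.403] -/
theorem sqrt_sub_mul_norm_le {κ₁ δ : ℝ} (hκ : ∀ g, κ₁ * ‖g‖ ^ 2 ≤ ‖A₁ g‖ ^ 2) (hδ : ∀ h, ‖A h - A₁ h‖ ≤ δ * ‖h‖) (g : G) :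
    (Real.sqrt κ₁ - δ) * ‖g‖ ≤ ‖A g‖ := by
  have h1 : Real.sqrt κ₁ * ‖g‖ ≤ ‖A₁ g‖ := sqrt_mul_le_of_mul_sq_le (norm_nonneg _) (norm_nonneg _) (hκ g)
  have h2 : ‖A₁ g‖ ≤ ‖A g‖ + ‖A g - A₁ g‖ := by
    calc ‖A₁ g‖ = ‖A g - (A g - A₁ g)‖ := by rw [sub_sub_cancel]
      _ ≤ ‖A g‖ + ‖A g - A₁ g‖ := norm_sub_le _ _
  nlinarith [h1, h2, hδ g]

/-- `1 − P` kills `range A`: `‖P₁ x − P (P₁ x)‖ ≤ δ‖T₁ x‖`. [folklore] [cite: Balaban1985BackgroundPropagators, (3.25) p.394, (3.65)–(3.67) p.403] -/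
theorem norm_proj_sub_le_delta (hPA : ∀ x, P x = A (T x)) (hfix : ∀ g, P (A g) = A g) (hsa : ∀ x y, ⟪P x, y⟫_𝕜 = ⟪x, P y⟫_𝕜)
    (hPA₁ : ∀ x, P₁ x = A₁ (T₁ x)) {δ : ℝ} (hδ : ∀ h, ‖A h - A₁ h‖ ≤ δ * ‖h‖) (x : E) : ‖P₁ x - P (P₁ x)‖ ≤ δ * ‖T₁ x‖ := by
  have e : P₁ x - P (P₁ x) = (A₁ (T₁ x) - A (T₁ x)) - P (A₁ (T₁ x) - A (T₁ x)) := by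
    rw [hPA₁ x, map_sub, hfix]; abel
  rw [e]
  calc ‖(A₁ (T₁ x) - A (T₁ x)) - P (A₁ (T₁ x) - A (T₁ x))‖ ≤ ‖A₁ (T₁ x) - A (T₁ x)‖ := norm_sub_proj_le hPA hfix hsa _
    _ = ‖A (T₁ x) - A₁ (T₁ x)‖ := norm_sub_rev _ _
    _ ≤ δ * ‖T₁ x‖ := hδ (T₁ x)

/-- `x − P₁ x` is orthogonal to `range A₁`. [folklore] [cite: Balaban1985BackgroundPropagators, (3.21) p.394] -/
theorem inner_sub_proj_apply_eq_zero (hfix₁ : ∀ g, P₁ (A₁ g) = A₁ g) (hsa₁ : ∀ x y, ⟪P₁ x, y⟫_𝕜 = ⟪x, P₁ y⟫_𝕜) (x : E) (g : G) :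
    ⟪x - P₁ x, A₁ g⟫_𝕜 = 0 := by
  rw [inner_sub_left, hsa₁, hfix₁, sub_self]

/-- For `z ⊥ range A₁`: `‖P z‖² = re⟪z, (A − A₁)(T z)⟫ ≤ ‖z‖·δ·‖T z‖`. [folklore] [cite: Balaban1985BackgroundPropagators, (3.65)–(3.67) p.403] -/
theorem norm_sq_proj_le_of_perp (hPA : ∀ x, P x = A (T x)) (hfix : ∀ g, P (A g) = A g) (hsa : ∀ x y, ⟪P x, y⟫_𝕜 = ⟪x, P y⟫_𝕜)
    {δ : ℝ} (hδ : ∀ h, ‖A h - A₁ h‖ ≤ δ * ‖h‖) {z : E} (hz : ∀ g, ⟪z, A₁ g⟫_𝕜 = 0) : ‖P z‖ ^ 2 ≤ ‖z‖ * (δ * ‖T z‖) := by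
  have e1 : ‖P z‖ ^ 2 = RCLike.re ⟪z, P z⟫_𝕜 := by
    rw [← inner_self_eq_norm_sq (𝕜 := 𝕜) (P z), hsa z (P z), proj_idem hPA hfix]
  have e2 : ⟪z, P z⟫_𝕜 = ⟪z, A (T z) - A₁ (T z)⟫_𝕜 := by
    rw [inner_sub_right, hz, sub_zero, hPA z]
  rw [e1, e2]
  calc RCLike.re ⟪z, A (T z) - A₁ (T z)⟫_𝕜 ≤ ‖z‖ * ‖A (T z) - A₁ (T z)‖ := re_inner_le_norm _ _
    _ ≤ ‖z‖ * (δ * ‖T z‖) := mul_le_mul_of_nonneg_left (hδ (T z)) (norm_nonneg _)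

/-- **THE ANCHORED GAP LEMMA**: only the reference generator `A₁` is coercive (`κ₁‖g‖² ≤ ‖A₁g‖²`), `‖Ah − A₁h‖ ≤ δ‖h‖`, window `2δ ≤ √κ₁` ⇒
`‖P x − P₁ x‖ ≤ (3δ∕√κ₁)‖x‖` (split `Px − P₁x = P(x − P₁x) − (P₁x − P(P₁x))`: the first piece by `norm_sq_proj_le_of_perp` and the coercivity of
`A` inherited through the window, the second by `norm_proj_sub_le_delta`). The same device as `B9Eq325RLipschitzSqrt.norm_starProjection_sub_le_of_generators`
(there in `Submodule.starProjection` dress, coercivity needed on one side only here). [folklore] [cite: Balaban1985BackgroundPropagators, p.403, (3.65)–(3.67) p.403, (3.25) p.394] -/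
theorem norm_proj_sub_proj_le_anchored (hPA : ∀ x, P x = A (T x)) (hfix : ∀ g, P (A g) = A g) (hsa : ∀ x y, ⟪P x, y⟫_𝕜 = ⟪x, P y⟫_𝕜)
    (hPA₁ : ∀ x, P₁ x = A₁ (T₁ x)) (hfix₁ : ∀ g, P₁ (A₁ g) = A₁ g) (hsa₁ : ∀ x y, ⟪P₁ x, y⟫_𝕜 = ⟪x, P₁ y⟫_𝕜)
    {κ₁ : ℝ} (hκ₁0 : 0 < κ₁) (hκ₁ : ∀ g, κ₁ * ‖g‖ ^ 2 ≤ ‖A₁ g‖ ^ 2)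
    {δ : ℝ} (hδ0 : 0 ≤ δ) (hδ : ∀ h, ‖A h - A₁ h‖ ≤ δ * ‖h‖) (hwin : 2 * δ ≤ Real.sqrt κ₁) (x : E) :
    ‖P x - P₁ x‖ ≤ 3 * δ / Real.sqrt κ₁ * ‖x‖ := by
  have hs : 0 < Real.sqrt κ₁ := Real.sqrt_pos.mpr hκ₁0
  have e : P x - P₁ x = P (x - P₁ x) - (P₁ x - P (P₁ x)) := by rw [map_sub]; abel
  set z := x - P₁ x with hzdef
  have hz : ∀ g, ⟪z, A₁ g⟫_𝕜 = 0 := inner_sub_proj_apply_eq_zero hfix₁ hsa₁ x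
  have hzle : ‖z‖ ≤ ‖x‖ := norm_sub_proj_le hPA₁ hfix₁ hsa₁ x
  have h1 := norm_sq_proj_le_of_perp hPA hfix hsa hδ hz (T := T)
  have h2 : Real.sqrt κ₁ * ‖T z‖ ≤ ‖P z‖ + δ * ‖T z‖ := by
    have := sqrt_sub_mul_norm_le hκ₁ hδ (T z)
    rw [← hPA z] at this
    nlinarith [this]
  have h3 : Real.sqrt κ₁ * ‖T z‖ ≤ 2 * ‖P z‖ := by
    have := mul_le_mul_of_nonneg_right hwin (norm_nonneg (T z))
    nlinarith [h2, this]
  have t1 : ‖P z‖ ≤ 2 * δ / Real.sqrt κ₁ * ‖x‖ := by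
    have h4 : Real.sqrt κ₁ * ‖P z‖ ^ 2 ≤ 2 * δ * ‖z‖ * ‖P z‖ := by
      have a := mul_le_mul_of_nonneg_left h1 (Real.sqrt_nonneg κ₁)
      have b : ‖z‖ * δ * (Real.sqrt κ₁ * ‖T z‖) ≤ ‖z‖ * δ * (2 * ‖P z‖) :=
        mul_le_mul_of_nonneg_left h3 (mul_nonneg (norm_nonneg _) hδ0)
      nlinarith [a, b]
    by_cases hp : ‖P z‖ = 0
    · rw [hp]; exact mul_nonneg (div_nonneg (by linarith) (Real.sqrt_nonneg _)) (norm_nonneg _)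
    · have hp' : 0 < ‖P z‖ := lt_of_le_of_ne (norm_nonneg _) (Ne.symm hp)
      have h5 : Real.sqrt κ₁ * ‖P z‖ ≤ 2 * δ * ‖z‖ := by
        have : Real.sqrt κ₁ * ‖P z‖ * ‖P z‖ ≤ 2 * δ * ‖z‖ * ‖P z‖ := by nlinarith [h4]
        exact le_of_mul_le_mul_right this hp'
      rw [div_mul_eq_mul_div, le_div_iff₀ hs]
      nlinarith [h5, hzle, hδ0]
  have t2 : ‖P₁ x - P (P₁ x)‖ ≤ δ / Real.sqrt κ₁ * ‖x‖ := by
    have a := norm_proj_sub_le_delta hPA hfix hsa hPA₁ hδ x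
    have b : Real.sqrt κ₁ * ‖T₁ x‖ ≤ ‖P₁ x‖ := sqrt_mul_norm_coeff_le hPA₁ hκ₁ x
    have c : ‖P₁ x‖ ≤ ‖x‖ := norm_proj_le hPA₁ hfix₁ hsa₁ x
    rw [div_mul_eq_mul_div, le_div_iff₀ hs]
    have a' := mul_le_mul_of_nonneg_right a (Real.sqrt_nonneg κ₁)
    have d : δ * (Real.sqrt κ₁ * ‖T₁ x‖) ≤ δ * ‖x‖ := mul_le_mul_of_nonneg_left (b.trans c) hδ0
    nlinarith [a', d]
  calc ‖P x - P₁ x‖ = ‖P z - (P₁ x - P (P₁ x))‖ := by rw [e]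
    _ ≤ ‖P z‖ + ‖P₁ x - P (P₁ x)‖ := norm_sub_le _ _
    _ ≤ 2 * δ / Real.sqrt κ₁ * ‖x‖ + δ / Real.sqrt κ₁ * ‖x‖ := add_le_add t1 t2
    _ = 3 * δ / Real.sqrt κ₁ * ‖x‖ := by ring

end Two

/-! ## §2 Oblique-projection geometry: range in `M`, defect killed by `P_N` ⇒ norm `≤ (1 − ‖P_M − P_N‖)⁻¹` -/

section Oblique

omit [InnerProductSpace 𝕜 E] in
/-- **THE TWO-PROJECTION BOUND**: `P_M Π = Π`, `P_N Π = P_N`, `‖P_M − P_N‖ ≤ θ`, `‖P_N‖ ≤ 1` ⇒ `(1 − θ)‖Π x‖ ≤ ‖x‖` (the norm of an idempotent through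
the angle between its range and the range of its adjoint). [folklore] [cite: Balaban1985BackgroundPropagators, (3.49) p.399] -/
theorem norm_le_of_two_proj {Pc PM PN : E → E} {θ : ℝ} (hM : ∀ x, PM (Pc x) = Pc x) (hN : ∀ x, PN (Pc x) = PN x)
    (hθ : ∀ v, ‖PM v - PN v‖ ≤ θ * ‖v‖) (hPN : ∀ v, ‖PN v‖ ≤ ‖v‖) (x : E) : (1 - θ) * ‖Pc x‖ ≤ ‖x‖ := by
  have h1 : ‖Pc x‖ ≤ ‖PM (Pc x) - PN (Pc x)‖ + ‖PN (Pc x)‖ := by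
    calc ‖Pc x‖ = ‖(PM (Pc x) - PN (Pc x)) + PN (Pc x)‖ := by rw [sub_add_cancel, hM]
      _ ≤ ‖PM (Pc x) - PN (Pc x)‖ + ‖PN (Pc x)‖ := norm_add_le _ _
  have h2 := hθ (Pc x)
  have h3 : ‖PN (Pc x)‖ ≤ ‖x‖ := by rw [hN]; exact hPN x
  nlinarith [h1, h2, h3]

omit [InnerProductSpace 𝕜 E] in
/-- … hence `‖Π x‖ ≤ ‖x‖∕(1 − θ)` for `θ < 1`. [folklore] [cite: Balaban1985BackgroundPropagators, (3.49) p.399] -/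
theorem norm_le_div_of_two_proj {Pc PM PN : E → E} {θ : ℝ} (hM : ∀ x, PM (Pc x) = Pc x) (hN : ∀ x, PN (Pc x) = PN x)
    (hθ : ∀ v, ‖PM v - PN v‖ ≤ θ * ‖v‖) (hPN : ∀ v, ‖PN v‖ ≤ ‖v‖) (hθ1 : θ < 1) (x : E) : ‖Pc x‖ ≤ ‖x‖ / (1 - θ) := by
  rw [le_div_iff₀ (by linarith), mul_comm]
  exact norm_le_of_two_proj hM hN hθ hPN x

end Oblique

/-! ## §3 The conjugate `Π = S P S⁻¹`: an oblique projection bounded through the anchored gap -/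

section Conj

variable {A Ap Am : G →ₗ[𝕜] E} {P PM PN S Sinv Sd H Hp : E →ₗ[𝕜] E} {Qdp : G →ₗ[𝕜] E} {Dop Dp : E →ₗ[𝕜] B} {T Tp Tm : E → G} {V W' : G → G}

/-- The duality letter read from the other side: `⟪S y, S^{−†} x⟫ = ⟪y, x⟫`. [folklore] [cite: Balaban1985BackgroundPropagators, (3.49) p.399] -/
theorem inner_S_Sd (hdual : ∀ x y, ⟪Sd x, S y⟫_𝕜 = ⟪x, y⟫_𝕜) (x y : E) : ⟪S y, Sd x⟫_𝕜 = ⟪y, x⟫_𝕜 := by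
  calc ⟪S y, Sd x⟫_𝕜 = (starRingEnd 𝕜) ⟪Sd x, S y⟫_𝕜 := (inner_conj_symm _ _).symm
    _ = (starRingEnd 𝕜) ⟪x, y⟫_𝕜 := by rw [hdual]
    _ = ⟪y, x⟫_𝕜 := inner_conj_symm _ _

/-- **(M)** The conjugated range lies in `M = range A₊` (`S (A g) = A₊ (V g)`), so `P_M Π = Π`. [folklore] [cite: Balaban1985BackgroundPropagators, (3.25) p.394, (3.49) p.399] -/
theorem projM_conj (hPA : ∀ x, P x = A (T x)) (hV : ∀ g, S (A g) = Ap (V g)) (hfixp : ∀ g, PM (Ap g) = Ap g) (x : E) :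
    PM (S (P (Sinv x))) = S (P (Sinv x)) := by
  rw [hPA, hV, hfixp]

/-- **(N)** `P_N` kills `S (ker P)`: with `range A₋ ⊆ S^{−†}(range A)` (`A₋ h = S^{−†}(A (W′ h))`) and `w − P w ⊥ range A`,
`‖P_N (S (w − P w))‖² = re⟪S (w − P w), S^{−†}A(…)⟫ = re⟪w − P w, A(…)⟫ = 0`. [folklore] [cite: Balaban1985BackgroundPropagators, (3.21) p.394, (3.49) p.399] -/
theorem projN_apply_S_sub_eq_zero (hfix : ∀ g, P (A g) = A g) (hsa : ∀ x y, ⟪P x, y⟫_𝕜 = ⟪x, P y⟫_𝕜)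
    (hPAm : ∀ x, PN x = Am (Tm x)) (hfixm : ∀ g, PN (Am g) = Am g) (hsam : ∀ x y, ⟪PN x, y⟫_𝕜 = ⟪x, PN y⟫_𝕜)
    (hAm : ∀ h, Am h = Sd (A (W' h))) (hdual : ∀ x y, ⟪Sd x, S y⟫_𝕜 = ⟪x, y⟫_𝕜) (w : E) : PN (S (w - P w)) = 0 := by
  set v := S (w - P w) with hv
  have e1 : ‖PN v‖ ^ 2 = RCLike.re ⟪v, PN v⟫_𝕜 := by
    rw [← inner_self_eq_norm_sq (𝕜 := 𝕜) (PN v), hsam v (PN v), proj_idem hPAm hfixm]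
  have e2 : ⟪v, PN v⟫_𝕜 = 0 := by
    rw [hPAm v, hAm, hv, inner_S_Sd hdual, inner_sub_proj_apply_eq_zero hfix hsa]
  have h0 : ‖PN v‖ ^ 2 = 0 := by rw [e1, e2, map_zero]
  simpa using h0

/-- … so `P_N Π = P_N` (`S S⁻¹ = 1`). [folklore] [cite: Balaban1985BackgroundPropagators, (3.49) p.399] -/
theorem projN_conj (hfix : ∀ g, P (A g) = A g) (hsa : ∀ x y, ⟪P x, y⟫_𝕜 = ⟪x, P y⟫_𝕜)
    (hPAm : ∀ x, PN x = Am (Tm x)) (hfixm : ∀ g, PN (Am g) = Am g) (hsam : ∀ x y, ⟪PN x, y⟫_𝕜 = ⟪x, PN y⟫_𝕜)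
    (hAm : ∀ h, Am h = Sd (A (W' h))) (hdual : ∀ x y, ⟪Sd x, S y⟫_𝕜 = ⟪x, y⟫_𝕜) (hSS : ∀ x, S (Sinv x) = x) (x : E) :
    PN (S (P (Sinv x))) = PN x := by
  have h := projN_apply_S_sub_eq_zero hfix hsa hPAm hfixm hsam hAm hdual (Sinv x)
  rw [map_sub, map_sub, hSS, sub_eq_zero] at h
  exact h.symm

/-- **THE CONJUGATED PROJECTION IS BOUNDED THROUGH THE GAP**: with `κ₁` the coercivity of the UNconjugated generator `A` only, `δ₊ = ‖A₊ − A‖`,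
`δ₋ = ‖A₋ − A‖` and the windows `2δ± ≤ √κ₁`: `(1 − 3(δ₊ + δ₋)∕√κ₁)·‖S P S⁻¹ x‖ ≤ ‖x‖` (§2 with `θ ≤ ‖P_M − P‖ + ‖P − P_N‖`, each by the anchored
gap lemma at the reference `A`). [folklore] [cite: Balaban1985BackgroundPropagators, (3.49) p.399, Thm 3.2 (3.48) p.398, (3.25) p.394] -/
theorem norm_conjProj_le (hPA : ∀ x, P x = A (T x)) (hfix : ∀ g, P (A g) = A g) (hsa : ∀ x y, ⟪P x, y⟫_𝕜 = ⟪x, P y⟫_𝕜)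
    {κ₁ : ℝ} (hκ₁0 : 0 < κ₁) (hκ₁ : ∀ g, κ₁ * ‖g‖ ^ 2 ≤ ‖A g‖ ^ 2)
    (hSS : ∀ x, S (Sinv x) = x) (hdual : ∀ x y, ⟪Sd x, S y⟫_𝕜 = ⟪x, y⟫_𝕜)
    (hV : ∀ g, S (A g) = Ap (V g)) (hPAp : ∀ x, PM x = Ap (Tp x)) (hfixp : ∀ g, PM (Ap g) = Ap g) (hsap : ∀ x y, ⟪PM x, y⟫_𝕜 = ⟪x, PM y⟫_𝕜)
    {δp : ℝ} (hδp0 : 0 ≤ δp) (hδp : ∀ h, ‖Ap h - A h‖ ≤ δp * ‖h‖) (hwinp : 2 * δp ≤ Real.sqrt κ₁)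
    (hAm : ∀ h, Am h = Sd (A (W' h))) (hPAm : ∀ x, PN x = Am (Tm x)) (hfixm : ∀ g, PN (Am g) = Am g) (hsam : ∀ x y, ⟪PN x, y⟫_𝕜 = ⟪x, PN y⟫_𝕜)
    {δm : ℝ} (hδm0 : 0 ≤ δm) (hδm : ∀ h, ‖Am h - A h‖ ≤ δm * ‖h‖) (hwinm : 2 * δm ≤ Real.sqrt κ₁) (x : E) :
    (1 - 3 * (δp + δm) / Real.sqrt κ₁) * ‖S (P (Sinv x))‖ ≤ ‖x‖ := by
  have hθ : ∀ v, ‖PM v - PN v‖ ≤ 3 * (δp + δm) / Real.sqrt κ₁ * ‖v‖ := by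
    intro v
    have h1 : ‖PM v - P v‖ ≤ 3 * δp / Real.sqrt κ₁ * ‖v‖ := norm_proj_sub_proj_le_anchored hPAp hfixp hsap hPA hfix hsa hκ₁0 hκ₁ hδp0 hδp hwinp v
    have h2 : ‖PN v - P v‖ ≤ 3 * δm / Real.sqrt κ₁ * ‖v‖ := norm_proj_sub_proj_le_anchored hPAm hfixm hsam hPA hfix hsa hκ₁0 hκ₁ hδm0 hδm hwinm v
    calc ‖PM v - PN v‖ = ‖(PM v - P v) - (PN v - P v)‖ := by rw [sub_sub_sub_cancel_right]
      _ ≤ ‖PM v - P v‖ + ‖PN v - P v‖ := norm_sub_le _ _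
      _ ≤ 3 * δp / Real.sqrt κ₁ * ‖v‖ + 3 * δm / Real.sqrt κ₁ * ‖v‖ := add_le_add h1 h2
      _ = 3 * (δp + δm) / Real.sqrt κ₁ * ‖v‖ := by ring
  exact norm_le_of_two_proj (Pc := fun x => S (P (Sinv x))) (projM_conj hPA hV hfixp)
    (projN_conj hfix hsa hPAm hfixm hsam hAm hdual hSS) hθ (norm_proj_le hPAm hfixm hsam) x

/-- **COROLLARY — THE LETTER FOR S-P5(b)**: windows `12δ₊ ≤ √κ₁`, `12δ₋ ≤ √κ₁` ⇒ `‖S P S⁻¹ x‖ ≤ 2‖x‖` — Combes–Thomas radius `∝ √κ₁`, bound `κ₁`-FREE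
(the comparand road through the five-factor product pays `κ₁⁻¹` at radius `∝ κ₁`). [folklore] [cite: Balaban1985BackgroundPropagators, (3.49) p.399, Thm 3.2 (3.48) p.398] -/
theorem norm_conjProj_le_two (hPA : ∀ x, P x = A (T x)) (hfix : ∀ g, P (A g) = A g) (hsa : ∀ x y, ⟪P x, y⟫_𝕜 = ⟪x, P y⟫_𝕜)
    {κ₁ : ℝ} (hκ₁0 : 0 < κ₁) (hκ₁ : ∀ g, κ₁ * ‖g‖ ^ 2 ≤ ‖A g‖ ^ 2)
    (hSS : ∀ x, S (Sinv x) = x) (hdual : ∀ x y, ⟪Sd x, S y⟫_𝕜 = ⟪x, y⟫_𝕜)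
    (hV : ∀ g, S (A g) = Ap (V g)) (hPAp : ∀ x, PM x = Ap (Tp x)) (hfixp : ∀ g, PM (Ap g) = Ap g) (hsap : ∀ x y, ⟪PM x, y⟫_𝕜 = ⟪x, PM y⟫_𝕜)
    {δp : ℝ} (hδp0 : 0 ≤ δp) (hδp : ∀ h, ‖Ap h - A h‖ ≤ δp * ‖h‖) (hwp : 12 * δp ≤ Real.sqrt κ₁)
    (hAm : ∀ h, Am h = Sd (A (W' h))) (hPAm : ∀ x, PN x = Am (Tm x)) (hfixm : ∀ g, PN (Am g) = Am g) (hsam : ∀ x y, ⟪PN x, y⟫_𝕜 = ⟪x, PN y⟫_𝕜)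
    {δm : ℝ} (hδm0 : 0 ≤ δm) (hδm : ∀ h, ‖Am h - A h‖ ≤ δm * ‖h‖) (hwm : 12 * δm ≤ Real.sqrt κ₁) (x : E) :
    ‖S (P (Sinv x))‖ ≤ 2 * ‖x‖ := by
  have hs : 0 < Real.sqrt κ₁ := Real.sqrt_pos.mpr hκ₁0
  have h := norm_conjProj_le hPA hfix hsa hκ₁0 hκ₁ hSS hdual hV hPAp hfixp hsap hδp0 hδp (by linarith) hAm hPAm hfixm hsam hδm0 hδm
    (by linarith) x
  have hθ : 3 * (δp + δm) / Real.sqrt κ₁ ≤ 1 / 2 := by rw [div_le_iff₀ hs]; linarith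
  have hθn : 0 ≤ (1 / 2 - 3 * (δp + δm) / Real.sqrt κ₁) * ‖S (P (Sinv x))‖ := mul_nonneg (by linarith) (norm_nonneg _)
  nlinarith [h, hθn]

/-! ## §4 The derivative is absorbed on the conjugated range `κ₁`-freely (the conjugated (I2)) -/

/-- **`D` IS ABSORBED ON THE CONJUGATED RANGE**: `‖D f‖² ≤ re⟪f, H f⟫` (`H = Δ′_a ≥ D†D`), `H₊ (A₊ h) = Q̃′†₊ h` (the conjugate of `Δ′_aG′ = 1`),
`‖Q̃′†₊ h‖ ≤ m‖h‖`, `‖h‖ ≤ C_g‖A₊ h‖`, `re⟪y, (H − H₊) y⟫ ≤ 2β‖D y‖‖y‖ + c‖y‖²` ⇒ `‖D (A₊ h)‖ ≤ (2β + √(m C_g + c))·‖A₊ h‖`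
(absorption `t² ≤ a + 2bt ⇒ t ≤ 2b + √a`). [folklore] [cite: Balaban1985BackgroundPropagators, (3.24)–(3.25) p.394, (3.49) p.399] -/
theorem norm_D_le_on_range (hHD : ∀ f, ‖Dop f‖ ^ 2 ≤ RCLike.re ⟪f, H f⟫_𝕜) (hHAp : ∀ h, Hp (Ap h) = Qdp h)
    {m Cg β c : ℝ} (hm0 : 0 ≤ m) (hCg0 : 0 ≤ Cg) (hβ0 : 0 ≤ β) (hc0 : 0 ≤ c) (hm : ∀ h, ‖Qdp h‖ ≤ m * ‖h‖) (hCg : ∀ h, ‖h‖ ≤ Cg * ‖Ap h‖)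
    (hHH : ∀ y, RCLike.re ⟪y, H y - Hp y⟫_𝕜 ≤ 2 * β * ‖Dop y‖ * ‖y‖ + c * ‖y‖ ^ 2) (h : G) :
    ‖Dop (Ap h)‖ ≤ (2 * β + Real.sqrt (m * Cg + c)) * ‖Ap h‖ := by
  have e : RCLike.re ⟪Ap h, H (Ap h)⟫_𝕜 = RCLike.re ⟪Ap h, Hp (Ap h)⟫_𝕜 + RCLike.re ⟪Ap h, H (Ap h) - Hp (Ap h)⟫_𝕜 := by
    rw [inner_sub_right, map_sub]; ring
  have h1 : RCLike.re ⟪Ap h, Hp (Ap h)⟫_𝕜 ≤ m * Cg * ‖Ap h‖ ^ 2 := by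
    calc RCLike.re ⟪Ap h, Hp (Ap h)⟫_𝕜 ≤ ‖Ap h‖ * ‖Hp (Ap h)‖ := re_inner_le_norm _ _
      _ = ‖Ap h‖ * ‖Qdp h‖ := by rw [hHAp]
      _ ≤ ‖Ap h‖ * (m * ‖h‖) := mul_le_mul_of_nonneg_left (hm h) (norm_nonneg _)
      _ ≤ ‖Ap h‖ * (m * (Cg * ‖Ap h‖)) := mul_le_mul_of_nonneg_left (mul_le_mul_of_nonneg_left (hCg h) hm0) (norm_nonneg _)
      _ = m * Cg * ‖Ap h‖ ^ 2 := by ring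
  -- the absorption `t² ≤ a + 2bt`, `a = (mC_g + c)‖A₊h‖²`, `b = β‖A₊h‖`
  set t := ‖Dop (Ap h)‖ with ht
  set a := (m * Cg + c) * ‖Ap h‖ ^ 2 with hadef
  set b := β * ‖Ap h‖ with hbdef
  have h2 : t ^ 2 ≤ a + 2 * b * t := by
    have h0 := hHD (Ap h)
    rw [e] at h0
    nlinarith [h0, h1, hHH (Ap h)]
  have ha : 0 ≤ a := by positivity
  have hb : 0 ≤ b := by positivity
  have h3 : t ≤ 2 * b + Real.sqrt a := by
    by_contra hle
    have hlt : 2 * b + Real.sqrt a < t := not_le.mp hle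
    have hs2 : Real.sqrt a ^ 2 = a := Real.sq_sqrt ha
    nlinarith [mul_pos (by linarith : (0 : ℝ) < t - 2 * b - Real.sqrt a) (by linarith [Real.sqrt_nonneg a] : (0 : ℝ) < t - 2 * b + Real.sqrt a),
      mul_nonneg hb (by linarith [Real.sqrt_nonneg a] : (0 : ℝ) ≤ t - 2 * b), hs2, h2]
  rw [hadef, Real.sqrt_mul' _ (sq_nonneg _), Real.sqrt_sq (norm_nonneg _)] at h3
  rw [hbdef] at h3
  nlinarith [h3]

/-- **THE CONJUGATED `D P`** (the bound S-P5(b) feeds to the Cauchy commutator step): under the §3 windows and the §4 letters, with `‖D₊ f − D f‖ ≤ β‖f‖`: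
`‖D₊ (S P S⁻¹ x)‖ ≤ 2(3β + √(m C_g + c))·‖x‖`. [folklore] [cite: Balaban1985BackgroundPropagators, (3.49) p.399, (3.24)–(3.25) p.394, Thm 3.2 (3.48) p.398] -/
theorem norm_conjDP_le_two (hPA : ∀ x, P x = A (T x)) (hfix : ∀ g, P (A g) = A g) (hsa : ∀ x y, ⟪P x, y⟫_𝕜 = ⟪x, P y⟫_𝕜)
    {κ₁ : ℝ} (hκ₁0 : 0 < κ₁) (hκ₁ : ∀ g, κ₁ * ‖g‖ ^ 2 ≤ ‖A g‖ ^ 2)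
    (hSS : ∀ x, S (Sinv x) = x) (hdual : ∀ x y, ⟪Sd x, S y⟫_𝕜 = ⟪x, y⟫_𝕜)
    (hV : ∀ g, S (A g) = Ap (V g)) (hPAp : ∀ x, PM x = Ap (Tp x)) (hfixp : ∀ g, PM (Ap g) = Ap g) (hsap : ∀ x y, ⟪PM x, y⟫_𝕜 = ⟪x, PM y⟫_𝕜)
    {δp : ℝ} (hδp0 : 0 ≤ δp) (hδp : ∀ h, ‖Ap h - A h‖ ≤ δp * ‖h‖) (hwp : 12 * δp ≤ Real.sqrt κ₁)
    (hAm : ∀ h, Am h = Sd (A (W' h))) (hPAm : ∀ x, PN x = Am (Tm x)) (hfixm : ∀ g, PN (Am g) = Am g) (hsam : ∀ x y, ⟪PN x, y⟫_𝕜 = ⟪x, PN y⟫_𝕜)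
    {δm : ℝ} (hδm0 : 0 ≤ δm) (hδm : ∀ h, ‖Am h - A h‖ ≤ δm * ‖h‖) (hwm : 12 * δm ≤ Real.sqrt κ₁)
    (hHD : ∀ f, ‖Dop f‖ ^ 2 ≤ RCLike.re ⟪f, H f⟫_𝕜) (hHAp : ∀ h, Hp (Ap h) = Qdp h)
    {m Cg β c : ℝ} (hm0 : 0 ≤ m) (hCg0 : 0 ≤ Cg) (hβ0 : 0 ≤ β) (hc0 : 0 ≤ c) (hm : ∀ h, ‖Qdp h‖ ≤ m * ‖h‖) (hCg : ∀ h, ‖h‖ ≤ Cg * ‖Ap h‖)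
    (hHH : ∀ y, RCLike.re ⟪y, H y - Hp y⟫_𝕜 ≤ 2 * β * ‖Dop y‖ * ‖y‖ + c * ‖y‖ ^ 2) (hDD : ∀ f, ‖Dp f - Dop f‖ ≤ β * ‖f‖) (x : E) :
    ‖Dp (S (P (Sinv x)))‖ ≤ 2 * (3 * β + Real.sqrt (m * Cg + c)) * ‖x‖ := by
  set y := S (P (Sinv x)) with hydef
  have hy : y = Ap (V (T (Sinv x))) := by rw [hydef, hPA, hV]
  have h1 : ‖Dop y‖ ≤ (2 * β + Real.sqrt (m * Cg + c)) * ‖y‖ := by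
    rw [hy]; exact norm_D_le_on_range hHD hHAp hm0 hCg0 hβ0 hc0 hm hCg hHH _
  have h2 : ‖Dp y‖ ≤ (3 * β + Real.sqrt (m * Cg + c)) * ‖y‖ := by
    calc ‖Dp y‖ = ‖(Dp y - Dop y) + Dop y‖ := by rw [sub_add_cancel]
      _ ≤ ‖Dp y - Dop y‖ + ‖Dop y‖ := norm_add_le _ _
      _ ≤ β * ‖y‖ + (2 * β + Real.sqrt (m * Cg + c)) * ‖y‖ := add_le_add (hDD y) h1
      _ = (3 * β + Real.sqrt (m * Cg + c)) * ‖y‖ := by ring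
  have h3 : ‖y‖ ≤ 2 * ‖x‖ :=
    norm_conjProj_le_two hPA hfix hsa hκ₁0 hκ₁ hSS hdual hV hPAp hfixp hsap hδp0 hδp hwp hAm hPAm hfixm hsam hδm0 hδm hwm x
  have hC : 0 ≤ 3 * β + Real.sqrt (m * Cg + c) := by positivity
  calc ‖Dp y‖ ≤ (3 * β + Real.sqrt (m * Cg + c)) * ‖y‖ := h2
    _ ≤ (3 * β + Real.sqrt (m * Cg + c)) * (2 * ‖x‖) := mul_le_mul_of_nonneg_left h3 hC
    _ = 2 * (3 * β + Real.sqrt (m * Cg + c)) * ‖x‖ := by ring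

end Conj

/-! ## §5 Non-vacuity: both hypothesis sets are jointly inhabited (identity maps on `𝕜`; a consistency check of the letters, not a lattice model) -/

/-- §3's letters at `κ₁ = 1`, `δ± = 0`, every map the identity of `𝕜`. [folklore] [cite: Balaban1985BackgroundPropagators, (3.49) p.399] -/
example (x : 𝕜) : ‖(LinearMap.id : 𝕜 →ₗ[𝕜] 𝕜) ((LinearMap.id : 𝕜 →ₗ[𝕜] 𝕜) ((LinearMap.id : 𝕜 →ₗ[𝕜] 𝕜) x))‖ ≤ 2 * ‖x‖ :=
  norm_conjProj_le_two (A := LinearMap.id) (Ap := LinearMap.id) (Am := LinearMap.id) (P := LinearMap.id) (PM := LinearMap.id) (PN := LinearMap.id)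
    (S := LinearMap.id) (Sinv := LinearMap.id) (Sd := LinearMap.id) (T := id) (Tp := id) (Tm := id) (V := id) (W' := id) (κ₁ := 1) (δp := 0) (δm := 0)
    (fun _ => rfl) (fun _ => rfl) (fun _ _ => rfl) one_pos (fun g => by simp) (fun _ => rfl) (fun _ _ => rfl)
    (fun _ => rfl) (fun _ => rfl) (fun _ => rfl) (fun _ _ => rfl) le_rfl (fun h => by simp) (by simp)
    (fun _ => rfl) (fun _ => rfl) (fun _ => rfl) (fun _ _ => rfl) le_rfl (fun h => by simp) (by simp) x

/-- §4's letters at `D = H = H₊ = A₊ = Q̃′†₊ = id` on `𝕜`, `m = C_g = 1`, `β = c = 0`. [folklore] [cite: Balaban1985BackgroundPropagators, (3.24) p.394] -/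
example (h : 𝕜) : ‖(LinearMap.id : 𝕜 →ₗ[𝕜] 𝕜) ((LinearMap.id : 𝕜 →ₗ[𝕜] 𝕜) h)‖ ≤ (2 * 0 + Real.sqrt (1 * 1 + 0)) * ‖(LinearMap.id : 𝕜 →ₗ[𝕜] 𝕜) h‖ :=
  norm_D_le_on_range (B := 𝕜) (Dop := LinearMap.id) (H := LinearMap.id) (Hp := LinearMap.id) (Ap := LinearMap.id) (Qdp := LinearMap.id)
    (fun f => by simp only [LinearMap.id_coe, id_eq]; exact (inner_self_eq_norm_sq (𝕜 := 𝕜) f).symm.le)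
    (fun _ => rfl) zero_le_one zero_le_one le_rfl le_rfl (fun h => by simp) (fun h => by simp) (fun y => by simp) h

end Literature.MathematicalPhysics.QuantumFieldTheory.Balaban1983to89.B9Eq349ConjugatedProjection
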